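import Literature.Geometry.Lorentzian.VacuumLocalLimit
import Literature.Geometry.Lorentzian.TameChartCompactnessExhaustion
import Literature.Geometry.Lorentzian.MetricLocality
import Literature.Geometry.Lorentzian.CoordNullRicciParallel
import HarnessLib

/-!
# Vacuum passes to chart limits of charts good on an exhaustion

Twin of `VacuumLocalLimit.lean` for charts `Ψₙ : ↥O → 𝓢ₙ` of Ricci-flat spacetimes which are smooth
and pinched only on the pieces over `W n` (`W 0 ≤ W 1 ≤ ⋯` exhausting `O`): the near-Minkowski limit
of their components is Ricci-flat (`NearMinkowskiChart.isRicciFlat_spacetime_of_tendsto_exhaustion`),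
hence the limit of the producer on an exhaustion is vacuum
(`Spacetime.exists_nearMinkowskiChart_subconvergesLocallyTo_of_exhaustion_isRicciFlat`). Ingredients:
the coordinate Ricci form is local in the components (`MetricCoord.ricAt_congr_metric`), and
the components of a chart good on a piece have vanishing Ricci form there (restrict the chart to the
open piece and apply the global lemma).

## References
* P. Petersen, *Riemannian Geometry*, 2nd ed., GTM 171, Springer 2006, Ch. 10, §3.2. [Petersen2006]
* B. O'Neill, *Semi-Riemannian geometry*, 1983, Ch. 3, Prop. 3.59, Lemma 3.52. [ONeill1983]
-/

noncomputable section

set_option maxSynthPendingDepth 3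

open Set Metric Filter Topology Function TopologicalSpace
open scoped Manifold ContDiff Topology ENNReal

universe u

namespace Literature.Geometry.Lorentzian

/-! ### Metric components: changing them consistently on the set -/

namespace MetricCoord

variable {E : Type*} [NormedAddCommGroup E] [NormedSpace ℝ E]
  {G G' : E → E →L[ℝ] E →L[ℝ] ℝ}

/-- `IsMetricOn` is invariant under changing the components off… nowhere: equal components on `V`.
[folklore] -/
theorem IsMetricOn.congr {V : Set E} (h : IsMetricOn G V) (heq : EqOn G' G V) : IsMetricOn G' V where
  isOpen := h.isOpen
  contDiffOn := h.contDiffOn.congr heq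
  symm y hy v w := by rw [heq hy]; exact h.symm y hy v w
  isInvertible y hy := by rw [heq hy]; exact h.isInvertible y hy

end MetricCoord

/-! ### Charts good on a piece: restriction to the piece -/

namespace Spacetime

variable (𝓢 : Spacetime.{u} 4) {O : Opens E4}

/-- The **restriction of a chart map to an open piece** `W ≤ O`. [folklore] -/
def restrictChart (Ψ : O → 𝓢.carrier) {W : Opens E4} (hW : W ≤ O) : W → 𝓢.carrier :=
  Ψ ∘ Opens.inclusion hW

/-- Smooth on the piece ⇒ the restriction is smooth. [folklore] -/
theorem contMDiff_restrictChart (Ψ : O → 𝓢.carrier) {W : Opens E4} (hW : W ≤ O)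
    (hΨ : ContMDiffOn 𝓘(ℝ, E4) (𝓡 4) ∞ Ψ (Subtype.val ⁻¹' (W : Set E4))) :
    ContMDiff 𝓘(ℝ, E4) (𝓡 4) ∞ (𝓢.restrictChart Ψ hW) :=
  hΨ.comp_contMDiff (contMDiff_inclusion (I := 𝓘(ℝ, E4)) (n := ∞) hW) fun z ↦ z.2

/-- The differential of the restriction is that of the chart. [folklore] -/
theorem mfderiv_restrictChart_apply (Ψ : O → 𝓢.carrier) {W : Opens E4} (hW : W ≤ O) (z : W)
    (hd : MDifferentiableAt 𝓘(ℝ, E4) (𝓡 4) Ψ (Opens.inclusion hW z)) (v : E4) :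
    mfderiv 𝓘(ℝ, E4) (𝓡 4) (𝓢.restrictChart Ψ hW) z v =
      mfderiv 𝓘(ℝ, E4) (𝓡 4) Ψ (Opens.inclusion hW z) v := by
  have h := DFunLike.congr_fun (mfderiv_comp z hd
    ((contMDiff_inclusion (I := 𝓘(ℝ, E4)) (n := ∞) hW).mdifferentiableAt (by simp))) v
  exact h.trans (congrArg (mfderiv 𝓘(ℝ, E4) (𝓡 4) Ψ (Opens.inclusion hW z))
    (OpensChart.mfderiv_inclusion_apply hW z v))

/-- **The components of the restriction and of the chart agree on the piece.** [folklore] -/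
theorem metricInCoords_restrictChart_eq (Ψ : O → 𝓢.carrier) {W : Opens E4} (hW : W ≤ O)
    (hΨ : ContMDiffOn 𝓘(ℝ, E4) (𝓡 4) ∞ Ψ (Subtype.val ⁻¹' (W : Set E4))) (zW : W) (zO : O)
    {y : E4} (hy : y ∈ (W : Set E4)) :
    𝓢.metricInCoords (𝓢.restrictChart Ψ hW ∘ (chartAt E4 zW).symm) y =
      𝓢.metricInCoords (Ψ ∘ (chartAt E4 zO).symm) y := by
  have hyO : y ∈ (O : Set E4) := hW hy
  have hdO : MDifferentiableAt 𝓘(ℝ, E4) (𝓡 4) Ψ ⟨y, hyO⟩ :=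
    𝓢.mdifferentiableAt_of_contMDiffOn_preimage (Minkowski.backgroundOn O) Ψ W.2 hΨ hyO hy
  have hdW : MDifferentiableAt 𝓘(ℝ, E4) (𝓡 4) (𝓢.restrictChart Ψ hW) ⟨y, hy⟩ :=
    ((𝓢.contMDiff_restrictChart Ψ hW hΨ) _).mdifferentiableAt (by simp)
  ext v w
  have hA := 𝓢.metricInCoords_comp_chartAt_symm_apply (Minkowski.backgroundOn W) (𝓢.restrictChart Ψ hW)
    zW hy hdW v w
  have hB := 𝓢.metricInCoords_comp_chartAt_symm_apply (Minkowski.backgroundOn O) Ψ zO hyO hdO v w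
  have hC := 𝓢.mfderiv_restrictChart_apply Ψ hW ⟨y, hy⟩ hdO
  refine hA.trans (Eq.trans ?_ hB.symm)
  exact congrArg₂ (fun s t ↦ 𝓢.metric.val (Ψ ⟨y, hyO⟩) s t) (hC v) (hC w)

/-- The norms of the deviations (from `η`) of the restriction and of the chart agree on the
piece. [folklore] -/
theorem norm_deviationExtend_restrictChart_eq (Ψ : O → 𝓢.carrier) {W : Opens E4} (hW : W ≤ O)
    (hΨ : ContMDiffOn 𝓘(ℝ, E4) (𝓡 4) ∞ Ψ (Subtype.val ⁻¹' (W : Set E4))) {y : E4}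
    (hy : y ∈ (W : Set E4)) :
    ‖𝓢.deviationExtend (Minkowski.backgroundOn W) (𝓢.restrictChart Ψ hW) y‖ =
      ‖𝓢.deviationExtend (Minkowski.backgroundOn O) Ψ y‖ := by
  have hyO : y ∈ (O : Set E4) := hW hy
  have hdO : MDifferentiableAt 𝓘(ℝ, E4) (𝓡 4) Ψ ⟨y, hyO⟩ :=
    𝓢.mdifferentiableAt_of_contMDiffOn_preimage (Minkowski.backgroundOn O) Ψ W.2 hΨ hyO hy
  have hdW : MDifferentiableAt 𝓘(ℝ, E4) (𝓡 4) (𝓢.restrictChart Ψ hW) ⟨y, hy⟩ :=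
    ((𝓢.contMDiff_restrictChart Ψ hW hΨ) _).mdifferentiableAt (by simp)
  have h1 := 𝓢.norm_metricInCoords_comp_chartAt_symm_sub_of_mdifferentiableAt
    (Minkowski.backgroundOn W) (𝓢.restrictChart Ψ hW) ⟨y, hy⟩ hy hdW
  have h2 := 𝓢.norm_metricInCoords_comp_chartAt_symm_sub_of_mdifferentiableAt
    (Minkowski.backgroundOn O) Ψ ⟨y, hyO⟩ hyO hdO
  have h3 := 𝓢.metricInCoords_restrictChart_eq Ψ hW hΨ ⟨y, hy⟩ ⟨y, hyO⟩ hy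
  refine h1.symm.trans (Eq.trans ?_ h2)
  show ‖𝓢.metricInCoords (𝓢.restrictChart Ψ hW ∘ (chartAt E4 (⟨y, hy⟩ : W)).symm) y - Minkowski.bilin‖ =
    ‖𝓢.metricInCoords (Ψ ∘ (chartAt E4 (⟨y, hyO⟩ : O)).symm) y - Minkowski.bilin‖
  rw [h3]

/-- **Components of a pinched chart of a Ricci-flat spacetime, good on a piece, have vanishing
Ricci form on the piece.** [cite: ONeill1983, Ch. 3, Prop. 3.59] -/
theorem ricAt_metricInCoords_eq_zero_of_isRicciFlat_of_contMDiffOn (Ψ : O → 𝓢.carrier)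
    {W : Opens E4} (hW : W ≤ O) (hΨ : ContMDiffOn 𝓘(ℝ, E4) (𝓡 4) ∞ Ψ (Subtype.val ⁻¹' (W : Set E4)))
    (h : ∀ y ∈ (W : Set E4), ‖𝓢.deviationExtend (Minkowski.backgroundOn O) Ψ y‖ < 1)
    (hvac : ∀ [𝓢.metric.toPseudoRiemannianMetric.HasLeviCivita],
      𝓢.metric.toPseudoRiemannianMetric.IsRicciFlat)
    (z₀ : O) {y : E4} (hy : y ∈ (W : Set E4)) :
    MetricCoord.ricAt (𝓢.metricInCoords (Ψ ∘ (chartAt E4 z₀).symm)) y = 0 := by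
  have h' : ∀ y' ∈ (W : Set E4),
      ‖𝓢.deviationExtend (Minkowski.backgroundOn W) (𝓢.restrictChart Ψ hW) y'‖ < 1 := fun y' hy' ↦
    (𝓢.norm_deviationExtend_restrictChart_eq Ψ hW hΨ hy').trans_lt (h y' hy')
  have h1 := 𝓢.ricAt_metricInCoords_eq_zero_of_isRicciFlat (𝓢.restrictChart Ψ hW)
    (𝓢.contMDiff_restrictChart Ψ hW hΨ)
    (𝓢.injective_mfderiv_of_norm_deviationExtend_lt_one _ (𝓢.contMDiff_restrictChart Ψ hW hΨ) h')
    hvac ⟨y, hy⟩ hy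
  have heq : 𝓢.metricInCoords (𝓢.restrictChart Ψ hW ∘ (chartAt E4 (⟨y, hy⟩ : W)).symm) =ᶠ[𝓝 y]
      𝓢.metricInCoords (Ψ ∘ (chartAt E4 z₀).symm) := by
    filter_upwards [W.2.mem_nhds hy] with y' hy'
    exact 𝓢.metricInCoords_restrictChart_eq Ψ hW hΨ ⟨y, hy⟩ z₀ hy'
  rw [← MetricCoord.ricAt_congr_metric heq]
  exact h1

end Spacetime

/-! ### Vacuum passes to the limit, exhaustion version -/

namespace NearMinkowskiChart

variable {𝓢ₙ : ℕ → Spacetime.{u} 4} {O : Opens E4}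

/-- **Chart limits of vacuum spacetimes, charts good on an exhaustion, are vacuum.**
[cite: Petersen2006, Ch. 10 §3.2] -/
theorem isRicciFlat_spacetime_of_tendsto_exhaustion (hO : IsConnected (O : Set E4))
    (W : ℕ → Opens E4) (hWO : ∀ n, (W n : Set E4) ⊆ (O : Set E4)) (hWm : Monotone W)
    (hWU : ∀ y ∈ (O : Set E4), ∃ n, y ∈ (W n : Set E4))
    (Ψ : ∀ n, O → (𝓢ₙ n).carrier)
    (hΨ : ∀ n, ContMDiffOn 𝓘(ℝ, E4) (𝓡 4) ∞ (Ψ n) (Subtype.val ⁻¹' (W n : Set E4)))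
    (hpinch : ∀ n, ∀ y ∈ (W n : Set E4),
      ‖(𝓢ₙ n).deviationExtend (Minkowski.backgroundOn O) (Ψ n) y‖ < 1)
    (hvac : ∀ n, ∀ [(𝓢ₙ n).metric.toPseudoRiemannianMetric.HasLeviCivita],
      (𝓢ₙ n).metric.toPseudoRiemannianMetric.IsRicciFlat)
    (L : NearMinkowskiChart O) {φ : ℕ → ℕ} (hφ : StrictMono φ) (z₀ : O)
    (hlim : ∀ y ∈ (O : Set E4), Tendsto (fun j ↦ supCkENorm ({y} : Set E4) 2
      ((𝓢ₙ (φ j)).metricInCoords (Ψ (φ j) ∘ (chartAt E4 z₀).symm) - L.G)) atTop (𝓝 0))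
    [(L.spacetime hO).metric.toPseudoRiemannianMetric.HasLeviCivita] :
    (L.spacetime hO).metric.toPseudoRiemannianMetric.IsRicciFlat := by
  refine L.isRicciFlat_spacetime_of_ricAt_eq_zero hO fun y hy ↦ ?_
  obtain ⟨j₀, hj₀⟩ := hWU y hy
  have hyW : ∀ j, j₀ ≤ j → y ∈ (W (φ j) : Set E4) := fun j hj ↦
    hWm (hj.trans (hφ.id_le j)) hj₀
  -- the shifted sequence has metric components on `V := W (φ j₀) ∋ y`
  let M : ℕ → E4 → E4 →L[ℝ] E4 →L[ℝ] ℝ := fun j ↦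
    (𝓢ₙ (φ (j + j₀))).metricInCoords (Ψ (φ (j + j₀)) ∘ (chartAt E4 z₀).symm)
  have hsub : ∀ j, (W (φ j₀) : Set E4) ⊆ (W (φ (j + j₀)) : Set E4) := fun j ↦
    hWm (hφ.monotone (Nat.le_add_left _ _))
  have hMon : ∀ j, MetricCoord.IsMetricOn (M j) (W (φ j₀) : Set E4) := by
    intro j
    have hle : W (φ (j + j₀)) ≤ O := hWO _
    have hyj : y ∈ (W (φ (j + j₀)) : Set E4) := hsub j (hyW j₀ le_rfl)
    have h' : ∀ y' ∈ (W (φ (j + j₀)) : Set E4), ‖(𝓢ₙ (φ (j + j₀))).deviationExtend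
        (Minkowski.backgroundOn (W (φ (j + j₀)))) ((𝓢ₙ _).restrictChart (Ψ _) hle) y'‖ < 1 :=
      fun y' hy' ↦
        ((𝓢ₙ _).norm_deviationExtend_restrictChart_eq (Ψ _) hle (hΨ _) hy').trans_lt (hpinch _ y' hy')
    have h1 := (𝓢ₙ (φ (j + j₀))).isMetricOn_metricInCoords ((𝓢ₙ _).restrictChart (Ψ _) hle)
      ((𝓢ₙ _).contMDiff_restrictChart (Ψ _) hle (hΨ _))
      ((𝓢ₙ _).injective_mfderiv_of_norm_deviationExtend_lt_one _
        ((𝓢ₙ _).contMDiff_restrictChart (Ψ _) hle (hΨ _)) h') ⟨y, hyj⟩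
    refine (h1.congr fun y' hy' ↦ ?_).mono (W (φ j₀)).2 (hsub j)
    exact ((𝓢ₙ _).metricInCoords_restrictChart_eq (Ψ _) hle (hΨ _) ⟨y, hyj⟩ z₀ hy').symm
  have hMs : ∀ j, ContDiffOn ℝ ∞ (M j) (W (φ j₀) : Set E4) := fun j ↦ (hMon j).contDiffOn
  obtain ⟨h0, h1, h2⟩ := tendsto_jets_of_tendsto_supCkENorm (W (φ j₀)).2 hMs
    (L.contDiffOn.mono (hWO _)) (hyW j₀ le_rfl) ((hlim y hy).comp (tendsto_add_atTop_nat j₀))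
  exact MetricCoord.ricAt_eq_zero_of_tendsto (l := atTop) (Gs := M) hMon
    (L.isMetricOn.mono (W (φ j₀)).2 (hWO _)) (hyW j₀ le_rfl) h0 h1 h2
    (Eventually.of_forall fun j ↦
      (𝓢ₙ (φ (j + j₀))).ricAt_metricInCoords_eq_zero_of_isRicciFlat_of_contMDiffOn (Ψ _)
        (show W (φ (j + j₀)) ≤ O from hWO _) (hΨ _) (hpinch _) (hvac _) z₀ (hsub j (hyW j₀ le_rfl)))

end NearMinkowskiChart

namespace Spacetime

variable {𝓢ₙ : ℕ → Spacetime.{u} 4} {pₙ : ∀ n, (𝓢ₙ n).carrier}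

/-- **Local Cheeger–Gromov compactness on an exhaustion, with far charts and vacuum**: the
producer `exists_nearMinkowskiChart_subconvergesLocallyWithFarChartsTo_of_exhaustion` together with
the implication "all sources Ricci-flat ⇒ the limit is Ricci-flat". [cite: Petersen2006, Ch. 10 §3.2] -/
theorem exists_nearMinkowskiChart_subconvergesLocallyWithFarChartsTo_of_exhaustion_vacuum
    (B : ModelBackground) (hO : IsConnected (B.domain : Set E4)) {y₀ : E4}
    (hy₀ : y₀ ∈ (B.domain : Set E4)) (W : ℕ → Opens E4)
    (hWO : ∀ n, (W n : Set E4) ⊆ (B.domain : Set E4)) (hWm : Monotone W)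
    (hWc : ∀ n, IsPreconnected (W n : Set E4)) (hW0 : y₀ ∈ (W 0 : Set E4))
    (hWU : ∀ y ∈ (B.domain : Set E4), ∃ n, y ∈ (W n : Set E4))
    (Ψ : ∀ n, B.domain → (𝓢ₙ n).carrier)
    (hΨ : ∀ n, ContMDiffOn 𝓘(ℝ, E4) (𝓡 4) ∞ (Ψ n) (Subtype.val ⁻¹' (W n : Set E4)))
    (hinj : ∀ n, InjOn (Ψ n) (Subtype.val ⁻¹' (W n : Set E4)))
    (hcentre : ∀ n, Ψ n ⟨y₀, hy₀⟩ = pₙ n)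
    (hfut : ∀ n, (𝓢ₙ n).timeOrientation.IsFutureDirected
      (mfderiv 𝓘(ℝ, E4) (𝓡 4) (Ψ n) ⟨y₀, hy₀⟩ (E4.basisVector 0)))
    {θ : ℝ} (hθ : θ < 1)
    (hpinch : ∀ n, ∀ y ∈ (W n : Set E4),
      ‖(𝓢ₙ n).deviationExtend (Minkowski.backgroundOn B.domain) (Ψ n) y‖ ≤ θ)
    (hbound : ∀ k : ℕ, ∃ Λ : ℝ≥0∞, Λ ≠ ⊤ ∧ ∀ n, supCkENorm (W n : Set E4) k
      ((𝓢ₙ n).deviationExtend (Minkowski.backgroundOn B.domain) (Ψ n)) ≤ Λ) :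
    ∃ (L : NearMinkowskiChart B.domain) (φ : ℕ → ℕ), StrictMono φ ∧
      (∀ y ∈ (B.domain : Set E4), ‖L.G y - Minkowski.bilin‖ ≤ θ) ∧
      (∀ (k : ℕ) (C : ℝ≥0∞), (∀ n, supCkENorm (W n : Set E4) k
          ((𝓢ₙ n).deviationExtend (Minkowski.backgroundOn B.domain) (Ψ n)) ≤ C) →
        supCkENorm (B.domain : Set E4) k (L.G - fun _ ↦ Minkowski.bilin) ≤ C) ∧
      (∀ (k : ℕ), ∀ K ⊆ (B.domain : Set E4), IsCompact K →
        Tendsto (fun j ↦ supCkENorm K k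
          ((𝓢ₙ (φ j)).deviationExtend (Minkowski.backgroundOn B.domain) (Ψ (φ j)) -
            (L.G - fun _ ↦ Minkowski.bilin))) atTop (𝓝 0)) ∧
      (∀ k : ℕ, SubconvergesLocallyWithFarChartsTo 𝓢ₙ pₙ (L.spacetime hO) ⟨y₀, hy₀⟩ k B Ψ
        (id : B.domain → (L.spacetime hO).carrier)) ∧
      ((∀ n, ∀ [(𝓢ₙ n).metric.toPseudoRiemannianMetric.HasLeviCivita],
          (𝓢ₙ n).metric.toPseudoRiemannianMetric.IsRicciFlat) →
        ∀ [(L.spacetime hO).metric.toPseudoRiemannianMetric.HasLeviCivita],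
          (L.spacetime hO).metric.toPseudoRiemannianMetric.IsRicciFlat) := by
  obtain ⟨L, φ, hφ, h1, h2, h3, h4⟩ :=
    exists_nearMinkowskiChart_subconvergesLocallyWithFarChartsTo_of_exhaustion B hO hy₀ W hWO hWm hWc
      hW0 hWU Ψ hΨ hinj hcentre hfut hθ hpinch hbound
  refine ⟨L, φ, hφ, h1, h2, h3, h4, fun hvac ↦ ?_⟩
  intro _
  refine L.isRicciFlat_spacetime_of_tendsto_exhaustion hO W hWO hWm hWU Ψ hΨ
    (fun n y hy ↦ (hpinch n y hy).trans_lt hθ) hvac (φ := φ) hφ ⟨y₀, hy₀⟩ fun y hy ↦ ?_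
  exact tendsto_supCkENorm_metricInCoords_sub_of_deviationExtend_exhaustion W hWO hWm hWU hΨ ⟨y₀, hy₀⟩
    L.G hφ (singleton_subset_iff.2 hy) isCompact_singleton
    (h3 2 {y} (singleton_subset_iff.2 hy) isCompact_singleton)

end Spacetime

end Literature.Geometry.Lorentzian

end
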